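import Literature.AlgebraicGeometry.HodgeTheory.ClassesSupportedOn
import Literature.AlgebraicTopology.SingularHomology.IntegralClassRingChange

/-!
# Torsion-freeness of the Zariski sheaves `𝓗ⁱ_X(ℤ)` (Colliot-Thélène–Voisin 2012, Théorème 3.1)

J.-L. Colliot-Thélène, C. Voisin, Duke Math. J. 161 (2012) 735–801 = arXiv:1005.2778
[ColliotTheleneVoisin2012] (unramified cohomology and the integral Hodge question), §3.1,
Théorème 3.1 (p. 7 of the arXiv text, read 2026-08-17):

> « Soit `X` une variété algébrique connexe sur `ℂ`. Pour tout entier `i`, la multiplication par un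
> entier `n > 0` sur les faisceaux `𝓗ᵖ_X(ℤ(i))` induit des suites exactes courtes de faisceaux
> Zariski sur `X`, `0 → 𝓗ᵖ_X(ℤ(i)) →×n 𝓗ᵖ_X(ℤ(i)) → 𝓗ᵖ_X(μ_n^{⊗i}) → 0`. En particulier les
> faisceaux `𝓗ᵖ_X(ℤ(i))` sont sans torsion, et donc leurs groupes de sections globales
> `H⁰(X, 𝓗ᵖ_X(ℤ(i))) = Hᵖ_nr(X, ℤ(i))` sont sans torsion. »

Here `𝓗ᵖ_X(A)` is the Zariski sheaf associated with the presheaf `U ↦ Hᵖ(U(ℂ); A)` (Déf. 2.1,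
Bloch–Ogus); the proof rests on the norm residue isomorphism theorem of Rost–Voevodsky
(formerly the Bloch–Kato question in Milnor K-theory), a THEOREM — so Théorème 3.1 is an
unconditional printed theorem, vendored here as a named fact.

## Transcription

The tree has no Zariski sheafification of Betti cohomology and no unramified cohomology, so we
record the **stalkwise** content of "`𝓗ᵖ_X(ℤ)` is torsion-free", which is equivalent to it (a sheaf of
abelian groups is torsion-free iff all its stalks are, and the stalk of the sheafification at `x` is
`colim_{U ∋ x} Hᵖ(U(ℂ); ℤ)`): a class on the complex points `(X ∖ Z)(ℂ)` of a Zariski open that is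
killed by some `N ≥ 1` vanishes on a smaller Zariski open neighbourhood `X ∖ Z'` (`Z ⊆ Z'`, `x ∉ Z'`)
of any prescribed point `x ∉ Z`. The twist `ℤ(i) ≅ ℤ` is invisible on Betti cohomology groups.
Carriers: `Motives.SchemeOver ℂ`, `Motives.IsSmoothProjective` (we SPECIALISE the printed "variété
algébrique connexe" to smooth projective geometrically irreducible `X`, the only case with carriers
in the tree and the one consumed by the Hodge routes), `Motives.complexPointsCompl`,
`HodgeTheory.complexPointsComplInclusion`, integral `singularCohomology ℤ ℤ`.

Grounds `Summit.HodgeConjecture.HodgeConjecture.Theses.GenericDivisibility.TorsionDiesGenerically`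
(stmt-HodgeConjecture-18469): that item is this fact applied at any point outside `Z` (which exists as
`Z ≠ univ`), forgetting which point.
-/

namespace Literature.AlgebraicGeometry.HodgeTheory

open Literature.AlgebraicGeometry.Motives Literature.AlgebraicTopology.SingularHomology

/-- **Colliot-Thélène–Voisin 2012, Théorème 3.1 (stalkwise form): the Zariski sheaves `𝓗^q_X(ℤ)`
of a smooth projective complex variety are torsion-free.** For `X` smooth projective of dimension
`n` over `ℂ`, a Zariski-closed `Z ⊆ X`, an integral class `w ∈ H^q((X ∖ Z)(ℂ); ℤ)` with `N • w = 0`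
for some `N ≥ 1`, and any point `x ∉ Z`, there is a Zariski-closed `Z' ⊇ Z` with `x ∉ Z'` such that
`w` restricts to `0` on `(X ∖ Z')(ℂ)`. (Printed for every connected complex algebraic variety and
every twist `ℤ(i)`; an unconditional theorem, via the Rost–Voevodsky norm residue isomorphism.)
[cite: ColliotTheleneVoisin2012, Théorème 3.1] -/
def ColliotTheleneVoisin2012_thm31_stalkTorsionFree : Prop :=
  ∀ ⦃n : ℕ⦄ ⦃X : SchemeOver ℂ⦄, IsSmoothProjective n X →
    ∀ (q : ℕ) (Z : Set X.left), IsClosed Z →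
      ∀ (w : singularCohomology ℤ ℤ (complexPointsCompl X Z) q) (N : ℕ), 1 ≤ N → N • w = 0 →
        ∀ x : X.left, x ∉ Z →
          ∃ (Z' : Set X.left) (h : Z ⊆ Z'), IsClosed Z' ∧ x ∉ Z' ∧
            singularCohomology.map ℤ ℤ (complexPointsComplInclusion h) q w = 0

end Literature.AlgebraicGeometry.HodgeTheory
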